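import Summits.CriticalPhenomena.PercolationContinuityZ3.Theorems.PercNearOneGluingNoHeavyLowerTailSahiCombFiveUpSetLattice

/-!
# The one-cube triangle functional at a thin edge: `TRI_W ≥ 0` from the five-up-set inequality (conditional theorem, lattice-general)

Support file of the one-cut programme (crux `NoHeavyLowerTail`, stmt-CriticalPhenomena-4575; cell `prim-masterthm`, seat P5 gen 7;
report `P5-LORENTZIAN-TEST.md` §11.1–11.3, §11.10, §12).

The triangle-class coefficient of (M⁺⁺-3) on a cell `(a,b,c)` is `TRI = 2Λ_∅ − Λ_xy − Λ_xz − Λ_yz + Λ_xyz` (report §10.3).  On a THIN edge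
(`a = |E_12| = 1`) the members `f ⊆ 2 × Y`, `g ⊆ 2 × Z` are nested pairs of up-sets `F₀ ⊆ F₁` (of `W = Y × Z`, as cylinders) and `G₀ ⊆ G₁`,
`h = P ⊆ W`, the antipode of `W` is `τ`, and the eight `Λ`'s are the counts below (report §11.10, `TRI_W` at `a = 1`).  This file proves, for EVERY
finite distributive lattice `W` with an order-reversing bijection `τ` (so in particular for `W = 2^b × 2^c` with complementation):

* `LatticeFiveUpSet.card_shell_inter_add'` — inclusion–exclusion for nested pairs;
* `LatticeFiveUpSet.triWOne` — the thin-edge one-cube triangle functional `2Λ_∅ − Λ_xy − Λ_xz − Λ_yz + Λ_xyz` (an integer);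
* **`LatticeFiveUpSet.triWOne_eq`** — the exact decomposition `TRI_W = slack(♠) + #(P ∩ (F₁\F₀) ∩ (G₁\G₀)) + K₁ + K₂` with the five-up-set slack and
  two Kleitman gaps `K₁ = #(P∩F₁∩G₀) − #(P∩τF₁∩G₀)`, `K₂ = #(P∩F₀∩G₁) − #(P∩F₀∩τG₁)` (report §11.3: `TRI = ⟨C,D⟩_h + P_x`, `P_x = slack + Harris + Harris`);
* **`LatticeFiveUpSet.triWOne_nonneg_of_lattice : FiveUpSetIneqLattice → 0 ≤ triWOne …`** — the thin-edge triangle functional is non-negative on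
  every finite distributive lattice, CONDITIONALLY on the five-up-set conjecture (♠_L) (`FiveUpSetIneqLattice`, typed in `…SahiCombFiveUpSetLattice`;
  census: `2^n` exhaustive `n ≤ 5` (cp-mpp kit j102546/7, prim-lf-1 SAT), products of chains incl. `[4]×[3]` exhaustive).
HONEST LABEL: a conditional theorem (hypothesis = an OPEN conjecture of ours) plus an unconditional identity and bookkeeping; the link from `triWOne`
on `2^b × 2^c` to the tree's (M⁺⁺-3) coefficient `hybCoeff` is the class-T bridge of report §10.3 (numerically verified, not in the tree). [this work]
-/

namespace Summit.CriticalPhenomena.PercolationContinuityZ3.Theorems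

namespace LatticeFiveUpSet

open Finset

variable {W : Type*} [DecidableEq W]

/-- Inclusion–exclusion for the shell box of two nested pairs: `#(S ∩ (A₁\A₀) ∩ (B₁\B₀)) + #(S ∩ A₁ ∩ B₀) + #(S ∩ A₀ ∩ B₁) = #(S ∩ A₁ ∩ B₁) + #(S ∩ A₀ ∩ B₀)`
for `A₀ ⊆ A₁`, `B₀ ⊆ B₁` (any finsets). [this work] -/
theorem card_shell_inter_add' (S A₀ A₁ B₀ B₁ : Finset W) (hA : A₀ ⊆ A₁) (hB : B₀ ⊆ B₁) :
    (S ∩ (A₁ \ A₀) ∩ (B₁ \ B₀)).card + (S ∩ A₁ ∩ B₀).card + (S ∩ A₀ ∩ B₁).card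
      = (S ∩ A₁ ∩ B₁).card + (S ∩ A₀ ∩ B₀).card := by
  have hE : (S ∩ A₁ ∩ B₀ ∪ S ∩ A₀ ∩ B₁).card + (S ∩ A₀ ∩ B₀).card = (S ∩ A₁ ∩ B₀).card + (S ∩ A₀ ∩ B₁).card := by
    have h := card_union_add_card_inter (S ∩ A₁ ∩ B₀) (S ∩ A₀ ∩ B₁)
    have hi : S ∩ A₁ ∩ B₀ ∩ (S ∩ A₀ ∩ B₁) = S ∩ A₀ ∩ B₀ := by
      ext s; simp only [mem_inter]
      constructor
      · rintro ⟨⟨⟨hs, -⟩, hb⟩, ⟨-, ha⟩, -⟩; exact ⟨⟨hs, ha⟩, hb⟩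
      · rintro ⟨⟨hs, ha⟩, hb⟩; exact ⟨⟨⟨hs, hA ha⟩, hb⟩, ⟨hs, ha⟩, hB hb⟩
    rw [hi] at h
    exact h
  have hU : S ∩ A₁ ∩ B₁ = (S ∩ (A₁ \ A₀) ∩ (B₁ \ B₀)) ∪ (S ∩ A₁ ∩ B₀ ∪ S ∩ A₀ ∩ B₁) := by
    ext s; simp only [mem_inter, mem_union, mem_sdiff]
    constructor
    · rintro ⟨⟨hs, ha1⟩, hb1⟩
      by_cases ha0 : s ∈ A₀
      · exact Or.inr (Or.inr ⟨⟨hs, ha0⟩, hb1⟩)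
      · by_cases hb0 : s ∈ B₀
        · exact Or.inr (Or.inl ⟨⟨hs, ha1⟩, hb0⟩)
        · exact Or.inl ⟨⟨hs, ha1, ha0⟩, hb1, hb0⟩
    · rintro (⟨⟨hs, ha1, -⟩, hb1, -⟩ | ⟨⟨hs, ha1⟩, hb0⟩ | ⟨⟨hs, ha0⟩, hb1⟩)
      · exact ⟨⟨hs, ha1⟩, hb1⟩
      · exact ⟨⟨hs, ha1⟩, hB hb0⟩
      · exact ⟨⟨hs, hA ha0⟩, hb1⟩
  have hd : Disjoint (S ∩ (A₁ \ A₀) ∩ (B₁ \ B₀)) (S ∩ A₁ ∩ B₀ ∪ S ∩ A₀ ∩ B₁) := by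
    rw [disjoint_left]
    intro s hs hs'
    simp only [mem_inter, mem_union, mem_sdiff] at hs hs'
    rcases hs' with ⟨⟨-, -⟩, hb0⟩ | ⟨⟨-, ha0⟩, -⟩
    · exact hs.2.2 hb0
    · exact hs.1.2.2 ha0
  rw [hU, card_union_of_disjoint hd]
  omega

/-- The thin-edge one-cube triangle functional `TRI_W` (report §11.10 at `a = 1`): with `t X := X.image τ`,
`Λ_∅ = #(P∩F₀∩G₀) + #(P∩F₁∩G₁)`, `Λ_xy = #(P∩tF₀∩G₁) + #(P∩tF₁∩G₀)`, `Λ_xz = #(P∩F₀∩tG₁) + #(P∩F₁∩tG₀)`,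
`Λ_yz = #(P∩tF₀∩tG₀) + #(P∩tF₁∩tG₁)`, `Λ_xyz = #(P∩tF₀∩tG₁) + #(P∩tF₁∩tG₀)`, and `TRI_W := 2Λ_∅ − Λ_xy − Λ_xz − Λ_yz + Λ_xyz` (an integer).
For `W = 2^b × 2^c`, `τ` = complementation, `F_i = f(i,·) × 2^c`, `G_j = 2^b × g(j,·)`, `P = h` this is `TRI(1,b,c)(f,g,h)` (report §10.3, §11.1). [this work] -/
def triWOne (τ : W ≃ W) (P F₀ F₁ G₀ G₁ : Finset W) : ℤ :=
  2 * (((P ∩ F₀ ∩ G₀).card : ℤ) + (P ∩ F₁ ∩ G₁).card)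
    - (((P ∩ F₀.image τ ∩ G₁).card : ℤ) + (P ∩ F₁.image τ ∩ G₀).card)
    - (((P ∩ F₀ ∩ G₁.image τ).card : ℤ) + (P ∩ F₁ ∩ G₀.image τ).card)
    - (((P ∩ F₀.image τ ∩ G₀.image τ).card : ℤ) + (P ∩ F₁.image τ ∩ G₁.image τ).card)
    + (((P ∩ F₀.image τ ∩ G₁.image τ).card : ℤ) + (P ∩ F₁.image τ ∩ G₀.image τ).card)

/-- **The thin-edge decomposition** (report §11.3, exact): for nested `F₀ ⊆ F₁`, `G₀ ⊆ G₁` and any `P`, `τ` injective,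
`TRI_W = slack(♠) + #(P ∩ (F₁\F₀) ∩ (G₁\G₀)) + [#(P∩F₁∩G₀) − #(P∩τF₁∩G₀)] + [#(P∩F₀∩G₁) − #(P∩F₀∩τG₁)]`, where
`slack(♠) = #(P∩F₁∩G₁) + #(P∩F₀∩G₀) − #(P∩F₁∩τG₀) − #(P∩τF₀∩G₁) − #(P∩τ(F₁\F₀)∩τ(G₁\G₀))`. [this work] -/
theorem triWOne_eq (τ : W ≃ W) (P F₀ F₁ G₀ G₁ : Finset W) (hF : F₀ ⊆ F₁) (hG : G₀ ⊆ G₁) :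
    triWOne τ P F₀ F₁ G₀ G₁ =
      ((((P ∩ F₁ ∩ G₁).card : ℤ) + (P ∩ F₀ ∩ G₀).card - (P ∩ F₁ ∩ G₀.image τ).card - (P ∩ F₀.image τ ∩ G₁).card
          - (P ∩ (F₁ \ F₀).image τ ∩ (G₁ \ G₀).image τ).card)
        + (P ∩ (F₁ \ F₀) ∩ (G₁ \ G₀)).card)
        + (((P ∩ F₁ ∩ G₀).card : ℤ) - (P ∩ F₁.image τ ∩ G₀).card)
        + (((P ∩ F₀ ∩ G₁).card : ℤ) - (P ∩ F₀ ∩ G₁.image τ).card) := by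
  have ie1 := card_shell_inter_add' P F₀ F₁ G₀ G₁ hF hG
  have hF' : F₀.image τ ⊆ F₁.image τ := image_subset_image hF
  have hG' : G₀.image τ ⊆ G₁.image τ := image_subset_image hG
  have ie2 := card_shell_inter_add' P (F₀.image τ) (F₁.image τ) (G₀.image τ) (G₁.image τ) hF' hG'
  rw [← image_sdiff F₁ F₀ τ.injective, ← image_sdiff G₁ G₀ τ.injective] at ie2
  unfold triWOne
  omega

/-- **`TRI_W ≥ 0` at a thin edge, conditionally on the five-up-set inequality** (report §11.3: (♠) ⟹ P_x ≥ 0 ⟹ TRI ≥ 0 on every cell with a block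
of size 1; here in the lattice-general one-cube form): for a finite distributive lattice `W` with an order-reversing bijection `τ` and up-sets
`P`, `F₀ ⊆ F₁`, `G₀ ⊆ G₁`, `FiveUpSetIneqLattice` gives `0 ≤ triWOne τ P F₀ F₁ G₀ G₁`.  Proof: `triWOne_eq`; the slack is `≥ 0` by the
hypothesis, the shell count is `≥ 0`, and the two brackets are Kleitman gaps (`card_inter_image_le` on the up-sets `P ∩ G₀`, `P ∩ F₀`). [this work] -/
theorem triWOne_nonneg_of_lattice (h5 : FiveUpSetIneqLattice) (W : Type) [DistribLattice W] [Fintype W] [DecidableEq W]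
    (τ : W ≃ W) (hτ : ∀ a b : W, τ a ≤ τ b ↔ b ≤ a) (P F₀ F₁ G₀ G₁ : Finset W)
    (hP : IsUpperSet (P : Set W)) (hF₀ : IsUpperSet (F₀ : Set W)) (hF₁ : IsUpperSet (F₁ : Set W))
    (hG₀ : IsUpperSet (G₀ : Set W)) (hG₁ : IsUpperSet (G₁ : Set W)) (hF : F₀ ⊆ F₁) (hG : G₀ ⊆ G₁) :
    0 ≤ triWOne τ P F₀ F₁ G₀ G₁ := by
  rw [triWOne_eq τ P F₀ F₁ G₀ G₁ hF hG]
  have hs := h5 W τ hτ P F₀ F₁ G₀ G₁ hP hF₀ hF₁ hG₀ hG₁ hF hG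
  have hPG₀ : IsUpperSet ((P ∩ G₀ : Finset W) : Set W) := by rw [coe_inter]; exact hP.inter hG₀
  have hPF₀ : IsUpperSet ((P ∩ F₀ : Finset W) : Set W) := by rw [coe_inter]; exact hP.inter hF₀
  have k1 := card_inter_image_le τ hτ (P ∩ G₀) F₁ hPG₀ hF₁
  have k2 := card_inter_image_le τ hτ (P ∩ F₀) G₁ hPF₀ hG₁
  have e1 : P ∩ G₀ ∩ F₁.image τ = P ∩ F₁.image τ ∩ G₀ := by
    rw [inter_assoc, inter_comm G₀, ← inter_assoc]
  have e2 : P ∩ G₀ ∩ F₁ = P ∩ F₁ ∩ G₀ := by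
    rw [inter_assoc, inter_comm G₀, ← inter_assoc]
  rw [e1, e2] at k1
  omega

end LatticeFiveUpSet

end Summit.CriticalPhenomena.PercolationContinuityZ3.Theorems
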